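import Summits.MatrixMultiplication.OmegaCensus.SmallFormats.MatMul22nPairingZeros
import Summits.MatrixMultiplication.OmegaCensus.SmallFormats.MatMul22nLoadedPlaneStructure
import HarnessLib

/-!
# ω-census family (a): ZERO entries of `Q` from the structure data (F7a, zero part)

Cell `pub-omega` (unit `pub-omega-tensor`, gen 40), topic `Summits/MatrixMultiplication/OmegaCensus` (sub-folder
`SmallFormats`). Framing (verbatim): lottery ticket; floor = certified bounds/negative ranges. HONEST FRAMING: M1-LEAN-BLUEPRINT F7a (zero entries): in the
vocabulary of `M1Structure.structure_package` (null lines `L v j` / `L' μ i` with `rep`, shapes of C-cells / R-cells), the entry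
`∑_{p,q} Y q p (W_s p ⬝ᵥ G_t q)` vanishes when `t` is a C-cell of row `v_t` and the column `μ_s` of `s` lies on the pair line of row `v_t`
(`EntryZeros.Q_eq_zero_G`), or when `s` is an R-cell of column `μ_s` and the row `v_t` of `t` lies on the pair line of column `μ_s` (`Q_eq_zero_W`).
Wrappers of `PairingZeros`. Nothing here is a bound on `ω`.
-/

namespace Summit.MatrixMultiplication.OmegaCensus.SmallFormats

open Finset Matrix
open Literature.Computability.AlgebraicComplexity
open Summit.MatrixMultiplication.OmegaCensus.RankOnePlaneCapGeneral

namespace EntryZeros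

variable {ι : Type*} [Fintype ι] {n : ℕ}

/-- **Zero, G-side.** `t` has the C-cell shape on `c⋆ = ∑ rep(L a) l • c l`, the column plane `b` of `s` is orthogonal to `c⋆` (null line of that block is the
same line: `L μ_s = L a`), and `W_s` has rows in `span b`. -/
theorem Q_eq_zero_G (β : BilinComp (mulBilin (ZMod 3) 2 2 n) ι) (Y : Matrix (Fin 2) (Fin 2) (ZMod 3)) (s t : ι)
    (c b : Fin 2 → (Fin n → ZMod 3)) (L : Fin 4 → Fin 4) (a μs : Fin 4)
    (hL1 : ∀ m, (∑ l, (![![1, 0], ![0, 1], ![1, 1], ![1, 2]] : Fin 4 → Fin 2 → ZMod 3) (L μs) l • c l) ⬝ᵥ b m = 0) (hμs : L μs = L a)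
    (η : Fin 2 → ZMod 3) (hG : ∀ q, (fun jj => β.g t (Matrix.single q jj (1 : ZMod 3))) = η q • ∑ l, (![![1, 0], ![0, 1], ![1, 1], ![1, 2]] : Fin 4 → Fin 2 → ZMod 3) (L a) l • c l)
    (hW : ∀ p, ∃ x : Fin 2 → ZMod 3, β.w s p = ∑ m, x m • b m) :
    (∑ p, ∑ q, Y q p * (β.w s p ⬝ᵥ (fun jj => β.g t (Matrix.single q jj (1 : ZMod 3))))) = 0 := by
  have h := PairingZeros.Q_eq_zero_of_G_line Y (fun q => (fun jj => β.g t (Matrix.single q jj (1 : ZMod 3)))) (β.w s)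
    (∑ l, (![![1, 0], ![0, 1], ![1, 1], ![1, 2]] : Fin 4 → Fin 2 → ZMod 3) (L a) l • c l) η hG b hW (fun m => by rw [← hμs]; exact hL1 m)
  exact h

/-- **Zero, W-side.** `s` has the R-cell shape on `n⋆ = ∑ rep(L' a') l • b l`, the row plane `c` of `t` is orthogonal to `n⋆` (`L' v_t = L' a'`), and `G_t` has
rows in `span c`. -/
theorem Q_eq_zero_W (β : BilinComp (mulBilin (ZMod 3) 2 2 n) ι) (Y : Matrix (Fin 2) (Fin 2) (ZMod 3)) (s t : ι)
    (b c : Fin 2 → (Fin n → ZMod 3)) (L' : Fin 4 → Fin 4) (a' vt : Fin 4)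
    (hL'1 : ∀ m, (∑ l, (![![1, 0], ![0, 1], ![1, 1], ![1, 2]] : Fin 4 → Fin 2 → ZMod 3) (L' vt) l • b l) ⬝ᵥ c m = 0) (hvt : L' vt = L' a')
    (ω : Fin 2 → ZMod 3) (hW : ∀ p, β.w s p = ω p • ∑ l, (![![1, 0], ![0, 1], ![1, 1], ![1, 2]] : Fin 4 → Fin 2 → ZMod 3) (L' a') l • b l)
    (hG : ∀ q, ∃ x : Fin 2 → ZMod 3, (fun jj => β.g t (Matrix.single q jj (1 : ZMod 3))) = ∑ m, x m • c m) :
    (∑ p, ∑ q, Y q p * (β.w s p ⬝ᵥ (fun jj => β.g t (Matrix.single q jj (1 : ZMod 3))))) = 0 := by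
  have h := PairingZeros.Q_eq_zero_of_W_line Y (fun q => (fun jj => β.g t (Matrix.single q jj (1 : ZMod 3)))) (β.w s)
    (∑ l, (![![1, 0], ![0, 1], ![1, 1], ![1, 2]] : Fin 4 → Fin 2 → ZMod 3) (L' a') l • b l) ω hW c hG (fun m => by rw [← hvt]; exact hL'1 m)
  exact h

end EntryZeros

end Summit.MatrixMultiplication.OmegaCensus.SmallFormats
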